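import Literature.NumberTheory.GaloisRepresentations.GalLayerSystemSubgroupLayers
import Literature.NumberTheory.GaloisRepresentations.GalLayerSystemUnitsField
import Literature.NumberTheory.GaloisRepresentations.GalLayerSystemIdele
import Literature.NumberTheory.GaloisRepresentations.IdeleCohomologySubgroups
import Literature.Algebra.Homology.InflationRestrictionHigher

/-!
# The relative inflation of a Galois layer system is injective on `H²` when `H¹` vanishes at subgroups
# (Serre, *Corps locaux* VII §6 Prop. 5 / X §4 Prop. 6, for the layers seen from an open subgroup `V ≤ Γ_F`)

Topic `NumberTheory/GaloisRepresentations`; namespace `Literature.NumberTheory.GaloisRepresentations.GalLayerData`.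
Definitions with bodies (the two identifications used to recognise the relative inflation as an inflation map) and
theorems; no named fact, no instance, no `sorry`; any field `F`.  Sequel of door-c6's `GalLayerSystemSubgroupLayers`
(`GalLayer.subgroupImage V E = H_E`, `subgroupImageRes V h : H_{E'} → H_E`, `D.relInf V h n =
groupCohomology.map (subgroupImageRes V h) (relBaseRepHom h) n`) and of the tree's `InflationRestrictionHigher`
(`inflation S A n`, `mono_inflation_succ`).

For a Galois layer system `D` over `F`, an open subgroup `V ≤ Γ_F` and layers `E ≤ E'` with `U_E ≤ V` (so that
`E ⊇ F̄^V`): the kernel `S` of `H_{E'} ↠ H_E` consists of the restrictions trivial on `E`, its invariants on `D_{E'}` are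
exactly `D_E` (descent axiom of `D`), and `relInf` is the inflation `H²(H_{E'}/S, (D_{E'})^S) → H²(H_{E'}, D_{E'})`
transported along `H_{E'}/S ≅ H_E`, `(D_{E'})^S ≅ D_E`.  Hence (`mono_inflation_succ` with `n = 1`):

* §2 `baseInvariantsEquiv : D_E ≃ₗ[ℤ] (D_{E'})^S`, `subgroupImageQuotKerEquiv : H_E ≃* H_{E'} ⧸ S`,
  `relLayerQuotCohomologyIso n : Hⁿ(H_{E'} ⧸ S, (D_{E'})^S) ≅ Hⁿ(H_E, Res D_E)` (Mathlib's `groupCohomology.mapIso`);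
* §3 **`relInf_eq_iso_inv_comp_inflation`** (`relInf = iso⁻¹ ≫ Inf`) and **`relInf_two_injective`**: if
  `H¹(H, Res_H D_{E'}) = 0` for every subgroup `H ≤ Gal(E'/F)`, then
  `D.relInf V h 2 : H²(H_E, Res D_E) → H²(H_{E'}, Res D_{E'})` is injective;
* §4 the two instances **`unitsDataGal_relInf_two_injective`** (Hilbert 90, `InflationRestriction.isZero_H1_res_units`:
  the Brauer inflation `Br(E/E ∩ F̄^V) ↪ Br(E'/E' ∩ F̄^V)`) and **`ideleData_relInf_two_injective`** (`F` a number field,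
  `IdeleCohomology.isZero_H1_res_ideleRep`);
* §5 the colimit form: `relInflG V hE n : Hⁿ(H_E, Res D_E) →+ Extⁿ_{C_V}(ℤ, Res_V lim D)` (door-c4's `inflG` from the
  trace layer `U_E ∩ V` of the group `V`, through door-c6's `relLayerCohomologyIso`), `relInflG_relInf`
  (`relInflG ∘ relInf = relInflG`), **`relInflG_two_injective`** (`F̄/F` Galois, `Γ_F` compact, `V` open: a class of
  `H²(H_E, Res D_E)` dying in `Ext²_{C_V}(ℤ, Res_V lim D)` is `0` — door-c4 `exists_stepG_eq_zero`, cofinality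
  `exists_traceOpenNormalSubgroup_le`, directedness of the layers, §3), and its instances
  **`unitsDataGal_relInflG_two_injective`**, **`ideleData_relInflG_two_injective`**.

Written for brick E3 of the permutation dévissage of lane «PT-Ш-S-TC» (crux `stmt-BirchSwinnertonDyer-19032`, cell bsd-eis, seat bsd-line-x1-p1-w3 gen 18, plan
`P2-MONO-SCOPING-w3g18.md` file P2-c).  HONEST FRAMING: a functoriality statement of finite group cohomology; nothing
arithmetic is proved here.

## References
* J.-P. Serre, *Local Fields*, GTM 67 (1979), VII §6 Proposition 5, X §4 Proposition 6. [Serre1979]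
* J. W. S. Cassels, A. Fröhlich (eds.), *Algebraic Number Theory* (1967), Ch. VII (J. Tate) §11.1. [CasselsFrohlichANT1967]
* J.-P. Serre, *Galois Cohomology*, Springer (1997), I §2.2 Proposition 8. [SerreGaloisCohomology1997]
* D. Harari, *Galois Cohomology and Class Field Theory*, Universitext (2020), §4.3, §13.1. [Harari2020]
-/

noncomputable section

open CategoryTheory CategoryTheory.Limits groupCohomology
open Field (absoluteGaloisGroup)
open Literature.Algebra.Homology

namespace Literature.NumberTheory.GaloisRepresentations

open IdeleClassBar

namespace GalLayerData

variable {F : Type} [Field F] (D : GalLayerData F) (V : Subgroup (absoluteGaloisGroup F))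
  {E E' : GalLayer F} (h : E ≤ E')

/-! ## §1 Abbreviations: `A = Res_{H_{E'}} D_{E'}`, `S = ker (H_{E'} → H_E)` -/

/-- `A := Res_{H_{E'}} D_{E'}`, the top layer restricted to the image `H_{E'}` of `V`. [cite: CasselsFrohlichANT1967, Ch. VII §11.1] -/
abbrev relTop (E' : GalLayer F) : Rep ℤ (GalLayer.subgroupImage V E') :=
  Rep.res (GalLayer.subgroupImage V E').subtype (D.obj E')

/-- `S := ker (res : H_{E'} → H_E)`. [cite: CasselsFrohlichANT1967, Ch. VII §11.1] -/
abbrev resKer : Subgroup (GalLayer.subgroupImage V E') := (GalLayer.subgroupImageRes V h).ker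

omit D in
/-- `res : H_{E'} → H_E` is surjective (`u|_E = (u|_{E'})|_E`). [cite: CasselsFrohlichANT1967, Ch. VII §11.1] -/
theorem subgroupImageRes_surjective : Function.Surjective (GalLayer.subgroupImageRes V h) := fun τ => by
  obtain ⟨u, rfl⟩ := GalLayer.toSubgroupImage_surjective V E τ
  exact ⟨GalLayer.toSubgroupImage V E' u, GalLayer.subgroupImageRes_toSubgroupImage V h u⟩

/-- `D.base h x` is fixed by `S`. [cite: CasselsFrohlichANT1967, Ch. VII §11.1] -/
theorem base_mem_invariants_resKer (x : D.V E) :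
    D.base h x ∈ Representation.invariants ((D.relTop V E').ρ.comp (resKer V h).subtype) := by
  rintro ⟨s, hs⟩
  change D.ρ E' ((s : GalLayer.subgroupImage V E') : E'.1 ≃ₐ[F] E'.1) (D.base h x) = D.base h x
  rw [← D.base_ρ_subgroupImageRes h s x, MonoidHom.mem_ker.1 hs]
  change D.base h (D.ρ E (1 : E.1 ≃ₐ[F] E.1) x) = D.base h x
  rw [map_one, Module.End.one_apply]

variable (hE : (E.openNormalSubgroup : Subgroup (absoluteGaloisGroup F)) ≤ V)

include hE in
/-- Conversely, when `U_E ≤ V`, every vector of `D_{E'}` fixed by `S` comes from `D_E` (descent: the restrictions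
`σ|_{E'}`, `σ ∈ U_E ≤ V`, lie in `S`). [cite: CasselsFrohlichANT1967, Ch. VII §11.1] -/
theorem exists_base_eq_of_mem_invariants_resKer (y : D.V E')
    (hy : y ∈ Representation.invariants ((D.relTop V E').ρ.comp (resKer V h).subtype)) :
    ∃ x : D.V E, D.base h x = y := by
  refine D.descent h y fun σ hσ => ?_
  have hmem : GalLayer.toSubgroupImage V E' ⟨σ, hE hσ⟩ ∈ resKer V h := by
    rw [MonoidHom.mem_ker, GalLayer.subgroupImageRes_toSubgroupImage]
    exact Subtype.ext ((GalLayer.coe_toSubgroupImage_apply V E ⟨σ, hE hσ⟩).trans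
      (E.restrictHom_eq_one_of_mem hσ))
  exact hy ⟨_, hmem⟩

/-! ## §2 The identifications `D_E ≅ (D_{E'})^S` and `H_E ≅ H_{E'}/S` -/

include hE in
/-- `x ↦ D.base h x : D_E → (D_{E'})^S` is bijective. [cite: CasselsFrohlichANT1967, Ch. VII §11.1] -/
theorem base_invariants_bijective :
    Function.Bijective (fun x : D.V E =>
      (⟨D.base h x, D.base_mem_invariants_resKer V h x⟩ :
        Representation.invariants ((D.relTop V E').ρ.comp (resKer V h).subtype))) :=
  -- (`Exists.imp`, not `obtain`: destructuring the existential here is pathologically slow for the unifier)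
  ⟨fun _ _ hxy => D.base_injective h (congrArg Subtype.val hxy), fun y =>
    (D.exists_base_eq_of_mem_invariants_resKer V h hE y.1 y.2).imp fun _ hx => Subtype.ext hx⟩

/-- **`D_E ≃ₗ[ℤ] (D_{E'})^S`** (the vectors of `A.quotientToInvariants S`). [cite: CasselsFrohlichANT1967, Ch. VII §11.1] -/
def baseInvariantsEquiv :
    D.V E ≃ₗ[ℤ] ((D.relTop V E').quotientToInvariants (resKer V h)).V :=
  LinearEquiv.ofBijective
    ({ toFun := fun x => ⟨D.base h x, D.base_mem_invariants_resKer V h x⟩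
       map_add' := fun x y => Subtype.ext (map_add (D.base h) x y)
       map_smul' := fun c x => Subtype.ext (map_zsmul (D.base h) c x) } :
      D.V E →ₗ[ℤ] ((D.relTop V E').quotientToInvariants (resKer V h)).V)
    (D.base_invariants_bijective V h hE)

omit D in
/-- **`H_E ≃* H_{E'} ⧸ S`** (first isomorphism theorem). [cite: CasselsFrohlichANT1967, Ch. VII §11.1] -/
def subgroupImageQuotKerEquiv : GalLayer.subgroupImage V E ≃* GalLayer.subgroupImage V E' ⧸ resKer V h :=
  (QuotientGroup.quotientKerEquivOfSurjective _ (subgroupImageRes_surjective V h)).symm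

omit D in
/-- `subgroupImageQuotKerEquiv (res τ) = [τ]`. [cite: CasselsFrohlichANT1967, Ch. VII §11.1] -/
theorem subgroupImageQuotKerEquiv_apply_res (τ : GalLayer.subgroupImage V E') :
    subgroupImageQuotKerEquiv V h (GalLayer.subgroupImageRes V h τ) = QuotientGroup.mk τ := by
  apply (subgroupImageQuotKerEquiv V h).symm.injective
  rw [MulEquiv.symm_apply_apply]
  rfl

/-- `A^S` as an `H_{E'} ⧸ S`-representation (Mathlib's `quotientToInvariants`). [cite: CasselsFrohlichANT1967, Ch. VII §11.1] -/
abbrev relQuot : Rep ℤ (GalLayer.subgroupImage V E' ⧸ resKer V h) :=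
  (D.relTop V E').quotientToInvariants (resKer V h)

/-- `x ↦ base x` intertwines `Res_{H_E} D_E`, viewed as an `H_{E'} ⧸ S`-module along `H_{E'} ⧸ S ≅ H_E`, with `A^S`.
[cite: CasselsFrohlichANT1967, Ch. VII §11.1] -/
theorem baseInvariantsEquiv_comp_ρ (q : GalLayer.subgroupImage V E' ⧸ resKer V h) :
    (D.baseInvariantsEquiv V h hE).toLinearMap ∘ₗ
        ((Rep.res (GalLayer.subgroupImage V E).subtype (D.obj E)).ρ.comp
          (subgroupImageQuotKerEquiv V h).symm.toMonoidHom) q =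
      (D.relQuot V h).ρ q ∘ₗ (D.baseInvariantsEquiv V h hE).toLinearMap := by
  induction q using QuotientGroup.induction_on with | H τ => ?_
  refine LinearMap.ext fun x => Subtype.ext ?_
  change D.base h (D.ρ E ((GalLayer.subgroupImageRes V h τ : GalLayer.subgroupImage V E) : E.1 ≃ₐ[F] E.1) x) =
    D.ρ E' ((τ : GalLayer.subgroupImage V E') : E'.1 ≃ₐ[F] E'.1) (D.base h x)
  exact D.base_ρ_subgroupImageRes h τ x

/-- **`Hⁿ(H_{E'}/S, (D_{E'})^S) ≅ Hⁿ(H_E, Res D_E)`** (Mathlib's `groupCohomology.mapIso` along the identifications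
`H_{E'} ⧸ S ≅ H_E`, `(D_{E'})^S ≅ D_E` of this section). [cite: CasselsFrohlichANT1967, Ch. VII §11.1] -/
def relLayerQuotCohomologyIso (n : ℕ) :
    groupCohomology (D.relQuot V h) n ≅
      groupCohomology (Rep.res (GalLayer.subgroupImage V E).subtype (D.obj E)) n :=
  groupCohomology.mapIso (subgroupImageQuotKerEquiv V h).symm (D.baseInvariantsEquiv V h hE).symm
    (fun q => LinearEquiv.isIntertwining_symm_isIntertwining
      (ρ := (Rep.res (GalLayer.subgroupImage V E).subtype (D.obj E)).ρ.comp
        (subgroupImageQuotKerEquiv V h).symm.toMonoidHom)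
      (σ := (D.relQuot V h).ρ) (D.baseInvariantsEquiv_comp_ρ V h hE) q) n

/-! ## §3 `relInf = iso ≫ inflation`, and injectivity on `H²` -/

/-- **The relative inflation is the inflation along `H_{E'} ↠ H_{E'}/S ≅ H_E`, up to the identifications of §2.**
[cite: Serre1979, VII §6 Proposition 5][cite: CasselsFrohlichANT1967, Ch. VII §11.1] -/
theorem relInf_eq_iso_inv_comp_inflation (n : ℕ) :
    D.relInf V h n = (D.relLayerQuotCohomologyIso V h hE n).inv ≫
      InflationRestriction.inflation (resKer V h) (D.relTop V E') n := by
  unfold relInf relLayerQuotCohomologyIso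
  rw [groupCohomology.mapIso_inv, ← groupCohomology.map_comp]
  refine groupCohomology.map_congr ?_ ?_ n
  · exact MonoidHom.ext fun _ => rfl
  · exact LinearMap.ext fun _ => rfl

include hE in
/-- **`relInf` is injective on `H²` when `H¹` vanishes at every subgroup of the top layer.**
[cite: Serre1979, VII §6 Proposition 5 and X §4 Proposition 6] -/
theorem relInf_two_injective
    (hH1 : ∀ H : Subgroup (E'.1 ≃ₐ[F] E'.1), IsZero (groupCohomology (Rep.res H.subtype (D.obj E')) 1)) :
    Function.Injective (D.relInf V h 2) := by
  -- `H¹(S, Res_S A) = 0`: transport `hH1` along `S ≃* S.map (H_{E'} ↪ Gal(E'/F))`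
  have hS1 : IsZero (groupCohomology (Rep.res (resKer V h).subtype (D.relTop V E')) 1) := by
    let e : resKer V h ≃* (resKer V h).map (GalLayer.subgroupImage V E').subtype :=
      (resKer V h).equivMapOfInjective _ Subtype.val_injective
    exact (hH1 ((resKer V h).map (GalLayer.subgroupImage V E').subtype)).of_iso
      (groupCohomology.mapIso e (LinearEquiv.refl ℤ _) (fun _ => rfl) 1)
  haveI : Mono (InflationRestriction.inflation (resKer V h) (D.relTop V E') 2) :=
    InflationRestriction.mono_inflation_succ (resKer V h) (D.relTop V E') 1 fun i hi hi' => by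
      obtain rfl : i = 1 := le_antisymm hi' hi
      exact hS1
  rw [D.relInf_eq_iso_inv_comp_inflation V h hE 2]
  exact (ModuleCat.mono_iff_injective _).1 inferInstance

end GalLayerData

/-! ## §4 The two instances: `Eˣ` (Hilbert 90) and `J_E` (Shapiro + Hilbert 90) -/

section Instances

variable (F : Type) [Field F] (V : Subgroup (absoluteGaloisGroup F)) {E E' : GalLayer F} (h : E ≤ E')
  (hE : (E.openNormalSubgroup : Subgroup (absoluteGaloisGroup F)) ≤ V)

include hE in
/-- **Brauer inflation injectivity seen from an open subgroup `V ≤ Γ_F`**: for layers `E ≤ E'` with `U_E ≤ V`,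
`relInf : H²(H_E, Eˣ) → H²(H_{E'}, E'ˣ)` is injective (Hilbert 90 at every subgroup of `Gal(E'/F)`,
`InflationRestriction.isZero_H1_res_units`). [cite: Serre1979, X §4 Proposition 6] -/
theorem unitsDataGal_relInf_two_injective [IsGalois F (AlgebraicClosure F)] :
    Function.Injective ((unitsDataGal F).relInf V h 2) := by
  haveI := E'.finiteDimensional
  haveI := E'.isGalois
  exact (unitsDataGal F).relInf_two_injective V h hE fun H => InflationRestriction.isZero_H1_res_units F E'.1 H

include hE in
/-- **Idèle inflation injectivity seen from an open subgroup `V ≤ Γ_F`** (`F` a number field): for layers `E ≤ E'`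
with `U_E ≤ V`, `relInf : H²(H_E, J_E) → H²(H_{E'}, J_{E'})` is injective (`H¹(U, J_{E'}) = 0` for every
`U ≤ Gal(E'/F)`, `IdeleCohomology.isZero_H1_res_ideleRep`). [cite: CasselsFrohlichANT1967, Ch. VII §11.1] -/
theorem ideleData_relInf_two_injective [NumberField F] :
    Function.Injective ((ideleData F).relInf V h 2) := by
  haveI := E'.numberField
  haveI := E'.isGalois
  exact (ideleData F).relInf_two_injective V h hE fun H =>
    IdeleCohomology.isZero_H1_res_ideleRep (F := F) (E := E'.1) H

end Instances

/-! ## §5 Colimit form: the relative inflation `Hⁿ(H_E, Res D_E) → Extⁿ_{C_V}(ℤ, Res_V lim D)` is injective on `H²` -/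

namespace GalLayerData

variable {F : Type} [Field F] (D : GalLayerData F) (V : Subgroup (absoluteGaloisGroup F)) {E : GalLayer F}
  (hE : (E.openNormalSubgroup : Subgroup (absoluteGaloisGroup F)) ≤ V)

/-- **The relative inflation to the limit**, `relInflG V hE n : Hⁿ(H_E, Res_{H_E} D_E) →+ Extⁿ_{C_V}(ℤ, Res_V lim D)`:
door-c4's `inflG` from the trace layer `U_E ∩ V` of the group `V`, precomposed with door-c6's identification
`relLayerCohomologyIso : Hⁿ(V ⧸ (U_E ∩ V), (Res_V lim D)^{U_E ∩ V}) ≅ Hⁿ(H_E, Res D_E)`.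
[cite: SerreGaloisCohomology1997, I §2.2 Proposition 8][cite: CasselsFrohlichANT1967, Ch. VII §11.1] -/
def relInflG (n : ℕ) :
    groupCohomology (Rep.res (GalLayer.subgroupImage V E).subtype (D.obj E)) n →+
      Abelian.Ext (DiscreteRep.triv (Γ := V) ℤ) ((DiscreteRep.resD ℤ V).obj D.toSystem.toD) n :=
  (DiscreteRep.LayerColimit.inflG (DiscreteRep.traceOpenNormalSubgroup V E.openNormalSubgroup)
      ((DiscreteRep.resD ℤ V).obj D.toSystem.toD) n).comp
    (D.relLayerCohomologyIso hE n).inv.hom.toAddMonoidHom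

/-- Formula. [cite: SerreGaloisCohomology1997, I §2.2 Proposition 8] -/
theorem relInflG_apply (n : ℕ) (c : groupCohomology (Rep.res (GalLayer.subgroupImage V E).subtype (D.obj E)) n) :
    D.relInflG V hE n c =
      DiscreteRep.LayerColimit.inflG (DiscreteRep.traceOpenNormalSubgroup V E.openNormalSubgroup)
        ((DiscreteRep.resD ℤ V).obj D.toSystem.toD) n ((D.relLayerCohomologyIso hE n).inv c) := rfl

set_option maxHeartbeats 400000 in
/-- **`relInflG ∘ relInf = relInflG`**: the relative inflations to the limit are compatible with the relative
inflations between layers. [cite: SerreGaloisCohomology1997, I §2.2 Proposition 8] -/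
theorem relInflG_relInf {E' : GalLayer F} (h : E ≤ E') (n : ℕ)
    (c : groupCohomology (Rep.res (GalLayer.subgroupImage V E).subtype (D.obj E)) n) :
    D.relInflG V ((GalLayer.coe_openNormalSubgroup_le h).trans hE) n (D.relInf V h n c) = D.relInflG V hE n c := by
  have hE' : (E'.openNormalSubgroup : Subgroup (absoluteGaloisGroup F)) ≤ V :=
    (GalLayer.coe_openNormalSubgroup_le h).trans hE
  have hstep := D.relLayerCohomologyIso_stepG hE hE' h n ((D.relLayerCohomologyIso hE n).inv c)
  rw [CategoryTheory.Iso.inv_hom_id_apply] at hstep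
  rw [relInflG_apply, relInflG_apply, ← hstep, CategoryTheory.Iso.hom_inv_id_apply,
    DiscreteRep.LayerColimit.inflG_stepG]

/-- **Injectivity of the relative inflation to the limit on `H²`** (`F̄/F` Galois, `Γ_F` compact, `V` open): if
`H¹(H, Res_H D_{E'}) = 0` for every layer `E'` and every `H ≤ Gal(E'/F)`, then
`relInflG V hE 2 : H²(H_E, Res D_E) → Ext²_{C_V}(ℤ, Res_V lim D)` is injective — a class dying in the limit dies
under some transition (door-c4 `exists_stepG_eq_zero` for the group `V`), the transitions are cofinal with the
relative inflations (`exists_traceOpenNormalSubgroup_le`, the dictionary `ofOpenNormalSubgroupGal`, directedness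
of the layers), and those are injective (`relInf_two_injective`).
[cite: Serre1979, X §4 Proposition 6][cite: SerreGaloisCohomology1997, I §2.2 Proposition 8] -/
theorem relInflG_two_injective [IsGalois F (AlgebraicClosure F)] [CompactSpace (absoluteGaloisGroup F)]
    (hV : IsOpen (V : Set (absoluteGaloisGroup F)))
    (hH1 : ∀ (E' : GalLayer F) (H : Subgroup (E'.1 ≃ₐ[F] E'.1)),
      IsZero (groupCohomology (Rep.res H.subtype (D.obj E')) 1)) :
    Function.Injective (D.relInflG V hE 2) := by
  haveI := DiscreteRep.LayerColimit.compactSpace_subgroup_of_isOpen V hV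
  refine (injective_iff_map_eq_zero _).2 fun c hc => ?_
  obtain ⟨W, hW, h0⟩ := DiscreteRep.LayerColimit.exists_stepG_eq_zero 2
    ((DiscreteRep.resD ℤ V).obj D.toSystem.toD) (DiscreteRep.traceOpenNormalSubgroup V E.openNormalSubgroup)
    ((D.relLayerCohomologyIso hE 2).inv c) hc
  -- cofinality: a layer `E' ≥ E` whose trace lies in `W`
  obtain ⟨V', -, hV'W⟩ := DiscreteRep.exists_traceOpenNormalSubgroup_le V hV W
  obtain ⟨E', hEE', hE₁E'⟩ := GalLayer.exists_ge_ge E (GalLayer.ofOpenNormalSubgroupGal V')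
  have hE'V' : (E'.openNormalSubgroup : Subgroup (absoluteGaloisGroup F)) ≤ V' := by
    have h' := GalLayer.coe_openNormalSubgroup_le hE₁E'
    rwa [GalLayer.openNormalSubgroup_ofOpenNormalSubgroupGal] at h'
  have hE'V : (E'.openNormalSubgroup : Subgroup (absoluteGaloisGroup F)) ≤ V :=
    (GalLayer.coe_openNormalSubgroup_le hEE').trans hE
  have htr : (DiscreteRep.traceOpenNormalSubgroup V E'.openNormalSubgroup : Subgroup V) ≤ W :=
    (DiscreteRep.traceOpenNormalSubgroup_mono V hE'V').trans hV'W
  -- the transition to the trace of `E'` kills the class, and it is the relative inflation `relInf V hEE'`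
  have hstep : DiscreteRep.LayerColimit.stepG (DiscreteRep.traceOpenNormalSubgroup V E.openNormalSubgroup)
      (DiscreteRep.traceOpenNormalSubgroup V E'.openNormalSubgroup)
      (DiscreteRep.traceOpenNormalSubgroup_mono V (GalLayer.coe_openNormalSubgroup_le hEE'))
      ((DiscreteRep.resD ℤ V).obj D.toSystem.toD) 2 ((D.relLayerCohomologyIso hE 2).inv c) = 0 := by
    rw [← DiscreteRep.LayerColimit.stepG_stepG _ W hW _ 2 _ htr, h0, map_zero]
  -- (explicit `congrArg` chains, not `rw`: rewriting inside these near-miss morphism terms is pathologically slow)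
  have hzero : (D.relLayerCohomologyIso hE'V 2).hom (DiscreteRep.LayerColimit.stepG
      (DiscreteRep.traceOpenNormalSubgroup V E.openNormalSubgroup)
      (DiscreteRep.traceOpenNormalSubgroup V E'.openNormalSubgroup)
      (DiscreteRep.traceOpenNormalSubgroup_mono V (GalLayer.coe_openNormalSubgroup_le hEE'))
      ((DiscreteRep.resD ℤ V).obj D.toSystem.toD) 2 ((D.relLayerCohomologyIso hE 2).inv c)) = 0 :=
    (congrArg (fun x => (D.relLayerCohomologyIso hE'V 2).hom x) hstep).trans (map_zero _)
  have key : D.relInf V hEE' 2 c = 0 :=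
    (congrArg (fun x => D.relInf V hEE' 2 x)
        (CategoryTheory.Iso.inv_hom_id_apply (D.relLayerCohomologyIso hE 2) c)).symm.trans
      ((D.relLayerCohomologyIso_stepG hE hE'V hEE' 2 ((D.relLayerCohomologyIso hE 2).inv c)).symm.trans hzero)
  exact D.relInf_two_injective V hEE' hE (hH1 E') (key.trans (map_zero _).symm)

end GalLayerData

section ColimitInstances

variable (F : Type) [Field F] (V : Subgroup (absoluteGaloisGroup F)) {E : GalLayer F}
  (hE : (E.openNormalSubgroup : Subgroup (absoluteGaloisGroup F)) ≤ V)

include hE in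
/-- **Local/global Brauer inflation injectivity at an open subgroup**: for `F̄/F` Galois with `Γ_F` compact, `V ≤ Γ_F`
open and a layer `E` with `U_E ≤ V`, the inflation `H²(H_E, Eˣ) → Ext²_{C_V}(ℤ, Res_V lim→ Eˣ)` is injective
(Hilbert 90 at every subgroup of every layer). [cite: Serre1979, X §4 Proposition 6] -/
theorem unitsDataGal_relInflG_two_injective [IsGalois F (AlgebraicClosure F)] [CompactSpace (absoluteGaloisGroup F)]
    (hV : IsOpen (V : Set (absoluteGaloisGroup F))) :
    Function.Injective ((unitsDataGal F).relInflG V hE 2) :=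
  (unitsDataGal F).relInflG_two_injective V hE hV fun E' H => by
    haveI := E'.finiteDimensional
    haveI := E'.isGalois
    exact InflationRestriction.isZero_H1_res_units F E'.1 H

include hE in
/-- **Idèle inflation injectivity at an open subgroup** (`F` a number field): for `V ≤ Γ_F` open and a layer `E` with
`U_E ≤ V`, the inflation `H²(H_E, J_E) → Ext²_{C_V}(ℤ, Res_V Ī)` is injective (`H¹(U, J_{E'}) = 0` at every subgroup of
every layer). [cite: CasselsFrohlichANT1967, Ch. VII §11.1][cite: Harari2020, §13.1] -/
theorem ideleData_relInflG_two_injective [NumberField F] (hV : IsOpen (V : Set (absoluteGaloisGroup F))) :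
    Function.Injective ((ideleData F).relInflG V hE 2) := by
  haveI : IsGalois F (AlgebraicClosure F) := {}
  haveI : CompactSpace (absoluteGaloisGroup F) := absoluteGaloisGroup_compactSpace F
  exact (ideleData F).relInflG_two_injective V hE hV fun E' H => by
    haveI := E'.numberField
    haveI := E'.isGalois
    exact IdeleCohomology.isZero_H1_res_ideleRep (F := F) (E := E'.1) H

end ColimitInstances

end Literature.NumberTheory.GaloisRepresentations

end
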